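import Literature.Barriers.RiemannHypothesis.EpsteinZetaRealZeros
import Literature.NumberTheory.QuadraticFields.BakerLimitFormulaLines
import HarnessLib

/-!
# Davenport–Heilbronn for Epstein zeta functions, 0: the twisted model of an integral form

Sibling of `Literature/Barriers/RiemannHypothesis/EpsteinZetaRealZeros.lean` (named fact
`DavenportHeilbronn1936b_epstein`, Davenport–Heilbronn 1936 I–II; Titchmarsh §10.25/§10.27). This
small DEFINITIONS file fixes the vocabulary of the Davenport–Heilbronn method at the level of forms,
used by the proof files `EpsteinZetaRealZerosDHShifts.lean` (analytic half: Kronecker–Weyl + Rouché)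
and the arithmetic siblings (construction of the twist):

* `DHEpstein.bqfZ A B C v`, `DHEpstein.bqfNat A B C v` — the value `Q(v) = Av₁² + Bv₁v₂ + Cv₂²` of an
  INTEGRAL form as an integer / natural number (so that `bqfEval A B C v = bqfNat A B C v` off the
  origin for positive definite `Q`, `bqfEval_eq_natCast`, and the general term of `ζ_Q` is the
  Dirichlet-series term `n^{-s}`, `n = Q(v) ∈ ℕ`, `epsteinTerm_eq_natCast_cpow`);
* `DHEpstein.twistWeight a A B C = a ∘ Q` and `DHEpstein.twistModel a A B C s = Σ'_v a(Q(v)) Q(v)^{-s}`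
  (the tree's `twistZeta` with this weight) — Davenport–Heilbronn's twisted function: D–H I §2
  "`Z(s) = … ∑ a(n) n^{-s}`" with "`a(n) = a(p₁)^{ν₁} ⋯ a(p_r)^{ν_r}`" completely multiplicative,
  `|a(p)| = 1`; D–H II §5 (5) "For any set of numbers `a(p)` with `|a(p)| = 1` we define a function
  `F_a(s)`"; it is what `ζ_Q(s + iτ)` becomes when each `p^{-iτ}` is replaced by `a(p)`. We take
  `a : ℕ →* ℂ` (completely multiplicative, `a(1) = 1`) with `|a(p)| = 1` on primes, whence
  `|a(n)| = 1` for `n ≥ 1` (`norm_map_eq_one`);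
* `DHEpstein.phase τ n = n^{-iτ}` — the phases of the vertical shift: `Q(v)^{-(s+iτ)} = Q(v)^{-iτ} Q(v)^{-s}`
  (`epsteinTerm_add_mul_I`), completely multiplicative in `n` (`phase_mul`).

Everything else here is elementary API (positivity and casts of `Q(v)`, norms of `n^{-s}`).

## References

* [DavenportHeilbronn1936a] H. Davenport, H. Heilbronn, *On the zeros of certain Dirichlet series I*,
  J. London Math. Soc. 11 (1936), 181–185, §2.
* [DavenportHeilbronn1936b] — *II*, ibid. 307–312, §5 eq. (5). (Both read in *The Collected Papers of
  H. A. Heilbronn*, Wiley 1988, pp. 272–279.)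
-/

noncomputable section

open Complex
open Literature.NumberTheory.QuadraticFields.BakerLimitFormula

namespace Literature.Barriers.RiemannHypothesis

namespace DHEpstein

variable {A B C : ℤ}

/-! ## Integral forms: the value `Q(v) ∈ ℕ` -/

/-- The integer value `Q(v) = A v₁² + B v₁ v₂ + C v₂²`. [folklore] -/
def bqfZ (A B C : ℤ) (v : ℤ × ℤ) : ℤ := A * v.1 ^ 2 + B * v.1 * v.2 + C * v.2 ^ 2

/-- The natural-number value `Q(v)` (junk `0` if negative). [folklore] -/
def bqfNat (A B C : ℤ) (v : ℤ × ℤ) : ℕ := (bqfZ A B C v).toNat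

/-- `bqfEval` of an integral form is the cast of the integer value. [folklore] -/
theorem bqfEval_intCast (A B C : ℤ) (v : ℤ × ℤ) :
    bqfEval (A : ℝ) (B : ℝ) (C : ℝ) v = (bqfZ A B C v : ℝ) := by
  unfold bqfEval bqfZ; push_cast; ring

/-- `Q(v) ≥ 1` off the origin for a positive definite integral form. [folklore] -/
theorem one_le_bqfZ (hQ : IsPosDefForm (A : ℝ) (B : ℝ) (C : ℝ)) {v : ℤ × ℤ} (hv : v ≠ 0) :
    1 ≤ bqfZ A B C v := by
  have h := hQ.eval_pos hv
  rw [bqfEval_intCast] at h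
  have : (0 : ℤ) < bqfZ A B C v := by exact_mod_cast h
  omega

/-- `Q(v) > 0` in `ℕ` off the origin. [folklore] -/
theorem bqfNat_pos (hQ : IsPosDefForm (A : ℝ) (B : ℝ) (C : ℝ)) {v : ℤ × ℤ} (hv : v ≠ 0) :
    0 < bqfNat A B C v := by
  have := one_le_bqfZ hQ hv
  unfold bqfNat; omega

/-- `Q(v) ≠ 0` in `ℕ` off the origin. [folklore] -/
theorem bqfNat_ne_zero (hQ : IsPosDefForm (A : ℝ) (B : ℝ) (C : ℝ)) {v : ℤ × ℤ} (hv : v ≠ 0) :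
    bqfNat A B C v ≠ 0 := (bqfNat_pos hQ hv).ne'

/-- `bqfEval` is the cast of the natural-number value off the origin. [folklore] -/
theorem bqfEval_eq_natCast (hQ : IsPosDefForm (A : ℝ) (B : ℝ) (C : ℝ)) {v : ℤ × ℤ} (hv : v ≠ 0) :
    bqfEval (A : ℝ) (B : ℝ) (C : ℝ) v = (bqfNat A B C v : ℝ) := by
  rw [bqfEval_intCast]
  have h1 := one_le_bqfZ hQ hv
  have : ((bqfNat A B C v : ℕ) : ℤ) = bqfZ A B C v := by
    unfold bqfNat; exact Int.toNat_of_nonneg (by omega)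
  exact_mod_cast this.symm

/-- Off the origin, the general term of `ζ_Q` is `n^{-s}` with `n = Q(v) ∈ ℕ`. [folklore] -/
theorem epsteinTerm_eq_natCast_cpow (hQ : IsPosDefForm (A : ℝ) (B : ℝ) (C : ℝ)) (s : ℂ)
    {v : ℤ × ℤ} (hv : v ≠ 0) :
    epsteinTerm (A : ℝ) (B : ℝ) (C : ℝ) s v = ((bqfNat A B C v : ℕ) : ℂ) ^ (-s) := by
  unfold epsteinTerm
  rw [if_neg hv, bqfEval_eq_natCast hQ hv, Complex.ofReal_natCast]

/-- `‖n^{-s}‖ = n^{-Re s}` for `n ≥ 1`. [folklore] -/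
theorem norm_natCast_cpow_neg {n : ℕ} (hn : n ≠ 0) (s : ℂ) :
    ‖((n : ℕ) : ℂ) ^ (-s)‖ = (n : ℝ) ^ (-s.re) := by
  rw [Complex.norm_natCast_cpow_of_pos (Nat.pos_of_ne_zero hn)]
  simp

/-- `‖Q(v)^{-s}‖ ≤ Q(v)^{-σ₀}` for `Re s ≥ σ₀` (as `Q(v) ≥ 1`). [folklore] -/
theorem norm_epsteinTerm_le_of_le_re (hQ : IsPosDefForm (A : ℝ) (B : ℝ) (C : ℝ)) {σ₀ : ℝ} {s : ℂ}
    (hs : σ₀ ≤ s.re) (v : ℤ × ℤ) :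
    ‖epsteinTerm (A : ℝ) (B : ℝ) (C : ℝ) s v‖ ≤ ‖epsteinTerm (A : ℝ) (B : ℝ) (C : ℝ) (σ₀ : ℂ) v‖ := by
  by_cases hv : v = 0
  · simp [epsteinTerm, hv]
  rw [epsteinTerm_eq_natCast_cpow hQ s hv, epsteinTerm_eq_natCast_cpow hQ _ hv,
    norm_natCast_cpow_neg (bqfNat_ne_zero hQ hv), norm_natCast_cpow_neg (bqfNat_ne_zero hQ hv),
    Complex.ofReal_re]
  have h1 : (1 : ℝ) ≤ bqfNat A B C v := by exact_mod_cast bqfNat_pos hQ hv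
  exact Real.rpow_le_rpow_of_exponent_le h1 (by linarith)

/-! ## The twisted model `Z_a(s) = Σ' a(Q(v)) Q(v)^{-s}` -/

/-- The weight `v ↦ a(Q(v))` of the twisted model. [cite: DavenportHeilbronn1936b, §5 (5)] -/
def twistWeight (a : ℕ → ℂ) (A B C : ℤ) : ℤ × ℤ → ℂ := fun v ↦ a (bqfNat A B C v)

/-- **The twisted model** `Z_a(s) = Σ'_{v} a(Q(v)) Q(v)^{-s}` (Davenport–Heilbronn's `F_a`, at the
level of the form: `ζ_Q(s + iτ)` with `p^{-iτ}` replaced by `a(p)`). [cite: DavenportHeilbronn1936b, §5 (5)] -/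
def twistModel (a : ℕ → ℂ) (A B C : ℤ) (s : ℂ) : ℂ :=
  twistZeta (twistWeight a A B C) (A : ℝ) (B : ℝ) (C : ℝ) s

/-- A completely multiplicative `a` with `|a(p)| = 1` on primes has `|a(n)| = 1` for `n ≥ 1`.
[folklore] -/
theorem norm_map_eq_one (a : ℕ →* ℂ) (ha : ∀ p : ℕ, p.Prime → ‖a p‖ = 1) :
    ∀ n : ℕ, n ≠ 0 → ‖a n‖ = 1 := by
  intro n
  induction n using Nat.strong_induction_on with
  | _ n ih =>
    intro hn
    rcases Nat.lt_or_ge n 2 with hlt | hge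
    · obtain rfl : n = 1 := by omega
      simp
    · set p := n.minFac
      have hpp : p.Prime := Nat.minFac_prime (by omega)
      obtain ⟨m, hm⟩ := Nat.minFac_dvd n
      have hm0 : m ≠ 0 := by rintro rfl; rw [mul_zero] at hm; exact hn hm
      have hmn : m < n := by
        have h2 := hpp.two_le
        rcases Nat.eq_or_lt_of_le (Nat.one_le_iff_ne_zero.2 hm0) with h1 | h1
        · rw [hm, ← h1]; omega
        · calc m < 2 * m := by omega
            _ ≤ p * m := Nat.mul_le_mul_right m h2
            _ = n := hm.symm
      rw [hm, map_mul, norm_mul, ha p hpp, ih m hmn hm0, one_mul]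

/-- `|a(n)| ≤ 1` for all `n` (the value at `0` is `0` or `1`). [folklore] -/
theorem norm_map_le_one (a : ℕ →* ℂ) (ha : ∀ p : ℕ, p.Prime → ‖a p‖ = 1) (n : ℕ) : ‖a n‖ ≤ 1 := by
  rcases eq_or_ne n 0 with rfl | hn
  · -- `a 0 = a 0 * a 0`
    have h : a 0 = a 0 * a 0 := by rw [← map_mul]
    rcases eq_or_ne (a 0) 0 with h0 | h0
    · rw [h0, norm_zero]; exact zero_le_one
    · have : a 0 = 1 := by
        have := mul_left_cancel₀ h0 (h.symm.trans (mul_one _).symm)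
        exact this
      rw [this, norm_one]
  · exact (norm_map_eq_one a ha n hn).le

/-- The weight of the twisted model is bounded by `1`. [folklore] -/
theorem norm_twistWeight_le (a : ℕ →* ℂ) (ha : ∀ p : ℕ, p.Prime → ‖a p‖ = 1) (A B C : ℤ)
    (v : ℤ × ℤ) : ‖twistWeight a A B C v‖ ≤ 1 :=
  norm_map_le_one a ha _

/-! ## The phases `n^{-iτ}` of a vertical shift -/

/-- The phase `n^{-iτ}`. [folklore] -/
def phase (τ : ℝ) (n : ℕ) : ℂ := ((n : ℕ) : ℂ) ^ (-((τ : ℂ) * I))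

/-- `|n^{-iτ}| = 1` for `n ≥ 1`. [folklore] -/
theorem norm_phase {n : ℕ} (hn : n ≠ 0) (τ : ℝ) : ‖phase τ n‖ = 1 := by
  unfold phase
  rw [Complex.norm_natCast_cpow_of_pos (Nat.pos_of_ne_zero hn)]
  simp

/-- `|n^{-iτ}| ≤ 1` for all `n` (junk value `0` or `1` at `n = 0`). [folklore] -/
theorem norm_phase_le_one (τ : ℝ) (n : ℕ) : ‖phase τ n‖ ≤ 1 := by
  rcases eq_or_ne n 0 with rfl | hn
  · unfold phase
    rcases eq_or_ne (-((τ : ℂ) * I)) 0 with h0 | h0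
    · simp [h0]
    · simp [zero_cpow h0]
  · exact (norm_phase hn τ).le

/-- `(mn)^{-iτ} = m^{-iτ} n^{-iτ}`. [folklore] -/
theorem phase_mul (τ : ℝ) (m n : ℕ) : phase τ (m * n) = phase τ m * phase τ n := by
  unfold phase
  push_cast
  exact natCast_mul_natCast_cpow m n _

/-- Shifting `s` by `iτ` multiplies the general term by the phase: `Q(v)^{-(s+iτ)} = Q(v)^{-iτ} Q(v)^{-s}`.
[folklore] -/
theorem epsteinTerm_add_mul_I (hQ : IsPosDefForm (A : ℝ) (B : ℝ) (C : ℝ)) (s : ℂ) (τ : ℝ)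
    (v : ℤ × ℤ) :
    epsteinTerm (A : ℝ) (B : ℝ) (C : ℝ) (s + τ * I) v =
      phase τ (bqfNat A B C v) * epsteinTerm (A : ℝ) (B : ℝ) (C : ℝ) s v := by
  by_cases hv : v = 0
  · simp [epsteinTerm, hv]
  have hn : ((bqfNat A B C v : ℕ) : ℂ) ≠ 0 := by exact_mod_cast bqfNat_ne_zero hQ hv
  rw [epsteinTerm_eq_natCast_cpow hQ _ hv, epsteinTerm_eq_natCast_cpow hQ _ hv, phase,
    neg_add, cpow_add _ _ hn, mul_comm]

end DHEpstein

end Literature.Barriers.RiemannHypothesis
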